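import Literature.AlgebraicGeometry.Resolution.ArithmeticalThreefoldsLocalDescentEmbChain5
import HarnessLib

/-!
# Cossart–Piltant 2019, Prop. 4.10: the (C4) chain re-keyed on CJS Thm. 1.4 (`B = ∅`) — part 6

Topic: `Literature/AlgebraicGeometry/Resolution` (proofs only: no new notions, no new named facts).

The chain `ArithmeticalThreefoldsLocalDescent{Steps, Kummer, KummerStableLocalRing, Layers, InertiaClimb,
InertiaStableLocalRing, InertiaHensel, DecompositionHead, MonomializationHead, Monomialization, Keyed,
EquivariantSplit}.lean` derives `CossartPiltant2019ReductionP` (Cossart–Piltant 2019, the residue-characteristic-`p`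
part of Prop. 4.10) from the local theorem, principalization, the descent inputs and — only as a PASS-THROUGH to the
rank-one reduction (C5) at its bottom — the non-embedded resolution of excellent surfaces `CossartJannsenSaito2020General`
(CJS Thm. 1.2).  Since (C5) is now served by the EMBEDDED theorem (`rankOne_reduction_of_cjsEmbedded`,
`ArithmeticalThreefoldsLocalRankReductionEmbeddedFrame.lean`), this file repeats the chain with the hypothesis
`CossartJannsenSaito2020General` replaced by `CossartJannsenSaito2020Embedded` (CJS Thm. 1.4, `B = ∅` — the type of
stub 1 of the `CleanModels` crux of the summit `ResolutionOfSingularities`); statements and proofs are otherwise those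
of the originals, verbatim (names: `…_of_emb_of_…` / `…_of_embPrinted_of_…`).

## Sources

* V. Cossart, O. Piltant, *Resolution of singularities of arithmetical threefolds*, J. Algebra 529 (2019),
  proof of Prop. 4.10 (arXiv v1: Prop. 4.8, pp. 53–54). [CossartPiltant2019]
* V. Cossart, O. Piltant, *Resolution of singularities of threefolds in positive characteristic I*, J. Algebra 320
  (2008), §§6–9. [CossartPiltant2008]
* V. Cossart, U. Jannsen, S. Saito, LNM 2270 (2020), Thm. 1.4, Cor. 1.5. [CossartJannsenSaito2020]
-/

noncomputable section

open CategoryTheory AlgebraicGeometry TopologicalSpace IsLocalRing _root_.Polynomial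
  _root_.IntermediateField

namespace Literature.AlgebraicGeometry.Resolution

universe u

/-! ## Extending automorphisms of subextensions to the algebraically closed ambient field -/

section Tools

variable {S E : Type u} [CommRing S] [Field E] [Algebra S E]

/-- If `E` is algebraic over `S`, it is algebraic over every subfield `M ∋ S`. [folklore] -/
private theorem isAlgebraic_subfield_of_isAlgebraic' [Algebra.IsAlgebraic S E]
    (hinj : Function.Injective (algebraMap S E)) (M : Subfield E)
    (hSM : ∀ s : S, algebraMap S E s ∈ M) : Algebra.IsAlgebraic M E := by
  refine ⟨fun e => ?_⟩
  obtain ⟨q, hq0, hqe⟩ := Algebra.IsAlgebraic.isAlgebraic (R := S) e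
  let f : S →+* M := (algebraMap S E).codRestrict M hSM
  have hf : Function.Injective f := by
    intro a b hab
    apply hinj
    have h := congrArg (fun z : M => (z : E)) hab
    exact h
  have hcomp : (algebraMap M E).comp f = algebraMap S E := RingHom.ext fun _ => rfl
  refine ⟨q.map f, (Polynomial.map_ne_zero_iff hf).mpr hq0, ?_⟩
  rw [Polynomial.aeval_def, Polynomial.eval₂_map, hcomp]
  rwa [Polynomial.aeval_def] at hqe

/-- **Automorphisms of subextensions extend to the ambient algebraically closed field**: for a
subfield `M ∋ S` of `E` (algebraically closed, algebraic over `S`), an intermediate field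
`N | M` and `τ ∈ Aut_M(N)`, some `S`-automorphism `σ` of `E` restricts to `τ` on `N` (`E | M`
is normal; `AlgEquiv.liftNormal`). [folklore] -/
private theorem exists_algEquiv_extends_of_isAlgClosed' [IsAlgClosed E] [Algebra.IsAlgebraic S E]
    (hinj : Function.Injective (algebraMap S E)) (M : Subfield E)
    (hSM : ∀ s : S, algebraMap S E s ∈ M) (N : IntermediateField M E) (τ : N ≃ₐ[M] N) :
    ∃ σ : E ≃ₐ[S] E, ∀ x : N, σ (x : E) = ((τ x : N) : E) := by
  haveI : Algebra.IsAlgebraic M E := isAlgebraic_subfield_of_isAlgebraic' hinj M hSM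
  haveI : IsAlgClosure M E :=
    { isAlgClosed := ‹IsAlgClosed E›, isAlgebraic := ‹Algebra.IsAlgebraic M E› }
  haveI : Normal M E := IsAlgClosure.normal M E
  let σ₀ : E ≃ₐ[M] E := τ.liftNormal E
  have hσ₀S : ∀ s : S, σ₀.toRingEquiv (algebraMap S E s) = algebraMap S E s := fun s =>
    σ₀.commutes (⟨algebraMap S E s, hSM s⟩ : M)
  refine ⟨AlgEquiv.ofRingEquiv hσ₀S, fun x => ?_⟩
  exact AlgEquiv.liftNormal_commutes τ E x

end Tools

set_option maxHeartbeats 1600000 in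
/-- (RE-KEYED on Cossart–Jannsen–Saito Thm. 1.4 with `B = ∅`: statement and proof as the original of the same name with `cjs`/`printed` replaced by `emb`/`embPrinted`, the rank-one reduction (C5) being served by `rankOne_reduction_of_cjsEmbedded` instead of the non-embedded CJS Thm. 1.2, which is no longer an input.) **The chain for (C4), keyed on the printed facts, from the two MINIMAL equivariant local
uniformizations.** The local theorem (CP 2019 Thm. 1.5), principalization (Prop. 4.4),
Cossart–Jannsen–Saito Thm. 1.2 and Thm. 1.4 (`B = ∅`), `hEqT` (equivariant local uniformization
for a group acting on the subfield `M′` with prime exponent `ℓ ≠ p`, residually trivially on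
`O_E ∩ M′`, each non-trivial element moving some `x ∈ M′` by exactly `v(x)`) and `hEqI`
(equivariant local uniformization, cofinal in one element `x₀`, for a group each of whose
elements acting non-trivially on `M′` moves a unit of `O_E ∩ M′` by a unit) give
`CossartPiltant2019ReductionP`: `hEqT` yields "`S` is stable by `G`" ([CoP1] Lemma 9.4) and
`hEqI` the stable local uniformization of the inertia field containing its henselian generator,
the two inputs of `cossartPiltant2019ReductionP_of_embPrinted_of_stableInertia`.
[cite: CossartPiltant2019, proof of Prop. 4.10 (arXiv v1: Prop. 4.8, pp. 53–54)]
[cite: CossartPiltant2008, Prop. 9.3, Lemma 9.4 and their proofs (HAL pp. 26–30)]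
[cite: ZariskiSamuel1960, Ch. VI §12] -/
theorem cossartPiltant2019ReductionP_of_embPrinted_of_equivariantLU_split
    (hloc : CossartPiltant2019Local.{u}) (h44 : CossartPiltant2019Principalization.{u})
    (hCJSE : CossartJannsenSaito2020Embedded.{u})
    (hEqT :
      ∀ (p : ℕ), p.Prime →
      ∀ (S : Type u) [CommRing S] [IsDomain S] [IsRegularLocalRing S],
        IsExcellentRing S → ringKrullDim S = 3 → CharP (ResidueField S) p →
        IsAdicComplete (maximalIdeal S) S →
      ∀ (E : Type u) [Field E] [Algebra S E], Function.Injective (algebraMap S E) →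
        IsAlgClosed E → Algebra.IsAlgebraic S E →
      ∀ (OE : ValuationSubring E), (∀ s : S, algebraMap S E s ∈ OE) →
        (∀ s ∈ maximalIdeal S, OE.valuation (algebraMap S E s) < 1) →
        (∀ y : OE, ∃ q : S[X], (∃ i, q.coeff i ∉ maximalIdeal S) ∧
          OE.valuation (q.eval₂ (algebraMap S E) y) < 1) →
      Nonempty OE.valuation.RankOne →
      ∀ (M' : Subfield E), (∀ s : S, algebraMap S E s ∈ M') →
      ∀ (H : Subgroup (E ≃ₐ[S] E)),
        (∀ σ ∈ H, ∀ x ∈ M', σ x ∈ M') →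
        (∀ σ ∈ H, ∀ x ∈ M', x ∈ OE → σ x ∈ OE) →
        (∀ σ ∈ H, ∀ x ∈ M', x ∈ OE → OE.valuation (σ x - x) < 1) →
        (∃ ℓ : ℕ, ℓ.Prime ∧ ℓ ≠ p ∧ ∀ σ ∈ H, ∀ x ∈ M', (σ ^ ℓ) x = x) →
        (∀ σ ∈ H, (∃ x ∈ M', σ x ≠ x) →
          ∃ x ∈ M', x ≠ 0 ∧ OE.valuation (σ x - x) = OE.valuation x) →
        (∃ t : Finset E, (t : Set E) ⊆ M' ∧
          M' ≤ Subfield.closure (Set.range (algebraMap S E) ∪ (t : Set E)) ∧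
          ∃ hTO : (Algebra.adjoin S (t : Set E)).toSubring ≤ OE.toSubring,
            IsRegularLocalRing (Localization.AtPrime
              (Ideal.comap (Subring.inclusion hTO) (maximalIdeal OE)))) →
        ∃ t : Finset E, (t : Set E) ⊆ M' ∧
          M' ≤ Subfield.closure (Set.range (algebraMap S E) ∪ (t : Set E)) ∧
          ∃ hTO : (Algebra.adjoin S (t : Set E)).toSubring ≤ OE.toSubring,
            IsRegularLocalRing (Localization.AtPrime
              (Ideal.comap (Subring.inclusion hTO) (maximalIdeal OE))) ∧
            (∀ σ ∈ H, ∀ x ∈ locAtCentre (Algebra.adjoin S (t : Set E)).toSubring OE,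
              σ x ∈ locAtCentre (Algebra.adjoin S (t : Set E)).toSubring OE))
    (hEqI :
      ∀ (p : ℕ), p.Prime →
      ∀ (S : Type u) [CommRing S] [IsDomain S] [IsRegularLocalRing S],
        IsExcellentRing S → ringKrullDim S = 3 → CharP (ResidueField S) p →
        IsAdicComplete (maximalIdeal S) S →
      ∀ (E : Type u) [Field E] [Algebra S E], Function.Injective (algebraMap S E) →
        IsAlgClosed E → Algebra.IsAlgebraic S E →
      ∀ (OE : ValuationSubring E), (∀ s : S, algebraMap S E s ∈ OE) →
        (∀ s ∈ maximalIdeal S, OE.valuation (algebraMap S E s) < 1) →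
        (∀ y : OE, ∃ q : S[X], (∃ i, q.coeff i ∉ maximalIdeal S) ∧
          OE.valuation (q.eval₂ (algebraMap S E) y) < 1) →
      Nonempty OE.valuation.RankOne →
      ∀ (M' : Subfield E), (∀ s : S, algebraMap S E s ∈ M') →
      ∀ (H : Subgroup (E ≃ₐ[S] E)),
        (∀ σ ∈ H, ∀ x ∈ M', σ x ∈ M') →
        (∀ σ ∈ H, ∀ x ∈ M', x ∈ OE → σ x ∈ OE) →
        (∀ σ ∈ H, (∃ x ∈ M', σ x ≠ x) →
          ∃ x ∈ M', OE.valuation x = 1 ∧ OE.valuation (σ x - x) = 1) →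
      ∀ (x₀ : E), x₀ ∈ M' → x₀ ∈ OE →
        (∃ t : Finset E, (t : Set E) ⊆ M' ∧
          M' ≤ Subfield.closure (Set.range (algebraMap S E) ∪ (t : Set E)) ∧
          ∃ hTO : (Algebra.adjoin S (t : Set E)).toSubring ≤ OE.toSubring,
            IsRegularLocalRing (Localization.AtPrime
              (Ideal.comap (Subring.inclusion hTO) (maximalIdeal OE)))) →
        ∃ t : Finset E, (t : Set E) ⊆ M' ∧
          M' ≤ Subfield.closure (Set.range (algebraMap S E) ∪ (t : Set E)) ∧
          ∃ hTO : (Algebra.adjoin S (t : Set E)).toSubring ≤ OE.toSubring,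
            IsRegularLocalRing (Localization.AtPrime
              (Ideal.comap (Subring.inclusion hTO) (maximalIdeal OE))) ∧
            (∀ σ ∈ H, ∀ x ∈ locAtCentre (Algebra.adjoin S (t : Set E)).toSubring OE,
              σ x ∈ locAtCentre (Algebra.adjoin S (t : Set E)).toSubring OE) ∧
            x₀ ∈ locAtCentre (Algebra.adjoin S (t : Set E)).toSubring OE) :
    CossartPiltant2019ReductionP.{u} := by
  classical
  refine cossartPiltant2019ReductionP_of_embPrinted_of_stableInertia hloc h44 hCJSE ?_ ?_
  · -- TAME LAYER: "S is stable by G" ([CoP1] Lemma 9.4), from `hEqT`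
    intro p hp S _ _ _ hSexc hSdim hSchar hScomp E _ _ hinj hE halg OE hSO hdom hres hrk ℓ hℓ hℓp
      ζ hζ A hSA hζA θ hθA hθℓ hvθ hfin hgal hinert hLU
    haveI : Fact p.Prime := ⟨hp⟩
    have hℓ0 : ℓ ≠ 0 := hℓ.ne_zero
    haveI : NeZero ℓ := ⟨hℓ0⟩
    -- residue characteristic and `v(ℓ) = 1`
    haveI hchar : CharP (ResidueField OE) p :=
      charP_residueField_valuationSubring_of_dominates OE p hSchar hSO hdom
    have hvℓ : OE.valuation (ℓ : E) = 1 := by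
      have hres0 : (ℓ : ResidueField OE) ≠ 0 := by
        intro h0
        have h1 : p ∣ ℓ := (CharP.cast_eq_zero_iff (ResidueField OE) p ℓ).mp h0
        exact hℓp ((Nat.prime_dvd_prime_iff_eq hp hℓ).mp h1).symm
      have hnotmem : (ℓ : OE) ∉ maximalIdeal OE := fun hmem => hres0 (by
        rw [← map_natCast (IsLocalRing.residue OE) ℓ, IsLocalRing.residue_eq_zero_iff]
        exact hmem)
      have h1 : OE.valuation ((ℓ : OE) : E) = 1 := by
        have hle : OE.valuation ((ℓ : OE) : E) ≤ 1 := (OE.valuation_le_one_iff _).mpr (ℓ : OE).2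
        have hnlt : ¬ OE.valuation ((ℓ : OE) : E) < 1 := fun hlt =>
          hnotmem ((ValuationSubring.valuation_lt_one_iff OE _).mpr hlt)
        exact le_antisymm hle (not_lt.mp hnlt)
      rwa [show ((ℓ : OE) : E) = (ℓ : E) from map_natCast OE.subtype ℓ] at h1
    have hθ0 : θ ≠ 0 := fun h => hθA (h ▸ A.zero_mem)
    set K₀ : IntermediateField A E := adjoin A ({θ} : Set E) with hK₀def
    have hθK : θ ∈ K₀ := mem_adjoin_simple_self A θ
    have hSK : ∀ s : S, algebraMap S E s ∈ K₀.toSubfield := fun s =>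
      K₀.algebraMap_mem (⟨algebraMap S E s, hSA s⟩ : A)
    -- every `τ ∈ Gal(A(θ)|A)` multiplies `θ` by an `ℓ`-th root of unity
    have hroot : ∀ τ : K₀ ≃ₐ[A] K₀, ∃ i, ((τ ⟨θ, hθK⟩ : K₀) : E) = ζ ^ i * θ := by
      intro τ
      set y : K₀ := ⟨θ, hθK⟩ with hy
      have hyℓ : y ^ ℓ = algebraMap A K₀ ⟨θ ^ ℓ, hθℓ⟩ := Subtype.ext (by
        rw [SubmonoidClass.coe_pow]; rfl)
      have hτy : ((τ y : K₀) : E) ^ ℓ = θ ^ ℓ := by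
        have h1 : τ (y ^ ℓ) = τ y ^ ℓ := map_pow τ y ℓ
        rw [hyℓ, AlgEquiv.commutes] at h1
        have h2 := congrArg (fun z : K₀ => (z : E)) h1
        simp only [SubmonoidClass.coe_pow] at h2
        rw [← h2]
        rfl
      have h1 : (((τ y : K₀) : E) / θ) ^ ℓ = 1 := by
        rw [div_pow, hτy, div_self (pow_ne_zero _ hθ0)]
      obtain ⟨i, -, hi⟩ := hζ.eq_pow_of_pow_eq_one h1
      exact ⟨i, by rw [hi, div_mul_cancel₀ _ hθ0]⟩
    -- an element of `Gal(A(θ)|A)` fixing `θ` is the identity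
    have htriv : ∀ τ : K₀ ≃ₐ[A] K₀, ((τ ⟨θ, hθK⟩ : K₀) : E) = θ → ∀ x : K₀, τ x = x := by
      intro τ hτθ x
      have hτ1 : τ = 1 := by
        apply AlgEquiv.coe_toAlgHom_injective
        refine IntermediateField.adjoin_algHom_ext A fun z hz => Subtype.ext ?_
        rw [Set.mem_singleton_iff] at hz
        subst hz
        rw [AlgEquiv.coe_toAlgHom, AlgEquiv.coe_toAlgHom, AlgEquiv.one_apply]
        exact hτθ
      rw [hτ1, AlgEquiv.one_apply]
    -- the group of `S`-automorphisms of `E` restricting to `Gal(A(θ)|A)`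
    let H : Subgroup (E ≃ₐ[S] E) :=
      { carrier := {σ | ∃ τ : K₀ ≃ₐ[A] K₀, ∀ x : K₀, σ (x : E) = ((τ x : K₀) : E)}
        one_mem' := ⟨1, fun x => rfl⟩
        mul_mem' := by
          rintro σ₁ σ₂ ⟨τ₁, h₁⟩ ⟨τ₂, h₂⟩
          refine ⟨τ₁ * τ₂, fun x => ?_⟩
          rw [AlgEquiv.mul_apply, AlgEquiv.mul_apply, h₂ x, h₁ (τ₂ x)]
        inv_mem' := by
          rintro σ ⟨τ, h⟩
          refine ⟨τ⁻¹, fun x => ?_⟩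
          rw [AlgEquiv.aut_inv, AlgEquiv.aut_inv, AlgEquiv.symm_apply_eq, h (τ.symm x),
            AlgEquiv.apply_symm_apply] }
    have hH1 : ∀ σ ∈ H, ∀ x ∈ K₀.toSubfield, σ x ∈ K₀.toSubfield := by
      rintro σ ⟨τ, hτ⟩ x hx
      rw [hτ ⟨x, hx⟩]
      exact (τ ⟨x, hx⟩).2
    have hH2 : ∀ σ ∈ H, ∀ x ∈ K₀.toSubfield, x ∈ OE → σ x ∈ OE := by
      rintro σ ⟨τ, hτ⟩ x hx hxO
      have hτi : τ ∈ inertiaGroupIn OE K₀ := by rw [hinert]; exact Subgroup.mem_top τ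
      rw [hτ ⟨x, hx⟩]
      exact (((mem_inertiaGroupIn_iff OE K₀ τ).mp hτi).1 ⟨x, hx⟩).mp hxO
    have hH3 : ∀ σ ∈ H, (∃ x ∈ K₀.toSubfield, σ x ≠ x) →
        ∃ x ∈ K₀.toSubfield, x ≠ 0 ∧ OE.valuation (σ x - x) = OE.valuation x := by
      rintro σ ⟨τ, hτ⟩ ⟨x, hx, hne⟩
      obtain ⟨i, hi⟩ := hroot τ
      refine ⟨θ, hθK, hθ0, ?_⟩
      rw [hτ ⟨θ, hθK⟩, hi]
      by_cases h1 : ζ ^ i = 1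
      · exfalso
        apply hne
        rw [hτ ⟨x, hx⟩]
        exact congrArg Subtype.val (htriv τ (by rw [hi, h1, one_mul]) ⟨x, hx⟩)
      · have hζi : (ζ ^ i) ^ ℓ = 1 := by
          rw [← pow_mul, mul_comm, pow_mul, hζ.pow_eq_one, one_pow]
        have h2 := valuation_pow_sub_self_eq_one OE hvℓ (one_pow ℓ) hζi
          (by rw [mul_one]; exact h1)
        rw [mul_one] at h2
        rw [show ζ ^ i * θ - θ = (ζ ^ i - 1) * θ by ring, map_mul, h2, one_mul]
    have hH4 : ∀ σ ∈ H, ∀ x ∈ K₀.toSubfield, x ∈ OE → OE.valuation (σ x - x) < 1 := by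
      rintro σ ⟨τ, hτ⟩ x hx hxO
      have hτi : τ ∈ inertiaGroupIn OE K₀ := by rw [hinert]; exact Subgroup.mem_top τ
      rw [hτ ⟨x, hx⟩]
      exact ((mem_inertiaGroupIn_iff OE K₀ τ).mp hτi).2 ⟨x, hx⟩ hxO
    have hH5 : ∃ ℓ' : ℕ, ℓ'.Prime ∧ ℓ' ≠ p ∧ ∀ σ ∈ H, ∀ x ∈ K₀.toSubfield, (σ ^ ℓ') x = x := by
      refine ⟨ℓ, hℓ, hℓp, ?_⟩
      rintro σ ⟨τ, hτ⟩ x hx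
      haveI : FiniteDimensional A K₀ := Module.finite_of_finrank_pos (by rw [hfin]; exact hℓ.pos)
      haveI : IsGalois A K₀ := hgal
      have hiter : ∀ (m : ℕ) (y : K₀), (σ ^ m) (y : E) = (((τ ^ m) y : K₀) : E) := by
        intro m
        induction m with
        | zero => intro y; rfl
        | succ m ih =>
          intro y
          rw [pow_succ, pow_succ, AlgEquiv.mul_apply, AlgEquiv.mul_apply, hτ y, ih (τ y)]
      have hτℓ : τ ^ ℓ = 1 := by
        rw [← hfin, ← IsGalois.card_aut_eq_finrank]
        exact pow_card_eq_one'
      have h1 := hiter ℓ ⟨x, hx⟩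
      rw [hτℓ, AlgEquiv.one_apply] at h1
      exact h1
    obtain ⟨t, htK, hKle, hTO, hreg, hstab⟩ := hEqT p hp S hSexc hSdim hSchar hScomp E hinj hE
      halg OE hSO hdom hres hrk K₀.toSubfield hSK H hH1 hH2 hH4 hH5 hH3 hLU
    refine ⟨t, htK, hKle, hTO, hreg, fun τ x hx => ?_⟩
    obtain ⟨σ, hσ⟩ := exists_algEquiv_extends_of_isAlgClosed' hinj A hSA K₀ τ
    have hσH : σ ∈ H := ⟨τ, hσ⟩
    rw [← hσ x]
    exact hstab σ hσH _ hx
  · -- INERTIA LAYER: the stable local uniformization of `Mⁱ` containing `η`, from `hEqI`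
    intro p hp S _ _ _ hSexc hSdim hSchar hScomp E _ _ hinj hE halg OE hSO hdom hres hrk M hSM
      N _ _ η hηV hηI hF hgen hLU
    obtain ⟨F, hFmon, hFcoeff, hFη, hF'⟩ := hF
    set Mi : Subfield E := (lift (fixedField (inertiaGroupIn OE N))).toSubfield with hMidef
    have hMiN : ∀ x ∈ Mi, x ∈ N := fun x hx => lift_le _ (show x ∈ lift _ from hx)
    have hηN : η ∈ N := hMiN η hηI
    have hSMi : ∀ s : S, algebraMap S E s ∈ Mi := fun s => le_lift_toSubfield _ (hSM s)
    -- the group of `S`-automorphisms of `E` restricting to `Gˢ` on `N`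
    let H : Subgroup (E ≃ₐ[S] E) :=
      { carrier := {σ | ∃ τ ∈ decompositionGroupIn OE N, ∀ x : N, σ (x : E) = ((τ x : N) : E)}
        one_mem' := ⟨1, one_mem _, fun x => rfl⟩
        mul_mem' := by
          rintro σ₁ σ₂ ⟨τ₁, hτ₁, h₁⟩ ⟨τ₂, hτ₂, h₂⟩
          refine ⟨τ₁ * τ₂, mul_mem hτ₁ hτ₂, fun x => ?_⟩
          rw [AlgEquiv.mul_apply, AlgEquiv.mul_apply, h₂ x, h₁ (τ₂ x)]
        inv_mem' := by
          rintro σ ⟨τ, hτ, h⟩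
          refine ⟨τ⁻¹, inv_mem hτ, fun x => ?_⟩
          rw [AlgEquiv.aut_inv, AlgEquiv.aut_inv, AlgEquiv.symm_apply_eq, h (τ.symm x),
            AlgEquiv.apply_symm_apply] }
    have hH1 : ∀ σ ∈ H, ∀ x ∈ Mi, σ x ∈ Mi := by
      rintro σ ⟨τ, hτs, hτ⟩ x hx
      rw [hτ ⟨x, hMiN x hx⟩]
      exact map_mem_inertiaField_of_mem_decompositionGroupIn OE N hx hτs
    have hH2 : ∀ σ ∈ H, ∀ x ∈ Mi, x ∈ OE → σ x ∈ OE := by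
      rintro σ ⟨τ, hτs, hτ⟩ x hx hxO
      rw [hτ ⟨x, hMiN x hx⟩]
      exact (((mem_decompositionGroupIn_iff OE N τ).mp hτs) ⟨x, hMiN x hx⟩).mp hxO
    have hH3 : ∀ σ ∈ H, (∃ x ∈ Mi, σ x ≠ x) →
        ∃ x ∈ Mi, OE.valuation x = 1 ∧ OE.valuation (σ x - x) = 1 := by
      rintro σ ⟨τ, hτs, hτ⟩ ⟨x, hx, hne⟩
      have hτi : τ ∉ inertiaGroupIn OE N := by
        intro hτi
        apply hne
        rw [hτ ⟨x, hMiN x hx⟩]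
        have hxfix : (⟨x, hMiN x hx⟩ : N) ∈ fixedField (inertiaGroupIn OE N) :=
          (IntermediateField.mem_lift (⟨x, hMiN x hx⟩ : N)).mp hx
        exact congrArg Subtype.val ((mem_fixedField_iff _ _).mp hxfix τ hτi)
      have hunit := valuation_map_sub_eq_one_of_henselRoot_inertiaField OE N hηV hηN F hFmon
        hFcoeff hFη hF' hgen hτs hτi
      by_cases hvη : OE.valuation η = 1
      · refine ⟨η, hηI, hvη, ?_⟩
        rw [hτ ⟨η, hηN⟩, hunit]
      · have hlt : OE.valuation η < 1 :=
          lt_of_le_of_ne ((OE.valuation_le_one_iff η).mpr hηV) hvη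
        have h1η : OE.valuation (1 + η) = 1 := Valuation.map_one_add_of_lt _ hlt
        refine ⟨1 + η, add_mem (one_mem _) hηI, h1η, ?_⟩
        rw [map_add, map_one, hτ ⟨η, hηN⟩,
          show (1 : E) + ((τ ⟨η, hηN⟩ : N) : E) - (1 + η) = ((τ ⟨η, hηN⟩ : N) : E) - η by ring,
          hunit]
    obtain ⟨t, htK, hKle, hTO, hreg, hstab, hηT⟩ := hEqI p hp S hSexc hSdim hSchar hScomp E hinj
      hE halg OE hSO hdom hres hrk Mi hSMi H hH1 hH2 hH3 η hηI hηV hLU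
    refine ⟨t, htK, hKle, hTO, hreg, fun τ hτs x hx => ?_, hηT⟩
    obtain ⟨σ, hσ⟩ := exists_algEquiv_extends_of_isAlgClosed' hinj M hSM N τ
    have hσH : σ ∈ H := ⟨τ, hτs, hσ⟩
    rw [← hσ x]
    exact hstab σ hσH _ hx


end Literature.AlgebraicGeometry.Resolution

end
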